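import Summits.BirchSwinnertonDyer.BirchSwinnertonDyer.Theorems.AdditiveKolyvaginRoadLevelSystems
import Summits.BirchSwinnertonDyer.BirchSwinnertonDyer.Theorems.KolyvaginRoadThreeZhangSupplyConjStable
import HarnessLib

/-!
# Route `AdditiveKolyvaginRoad`, crux `KolyvaginPrimitiveAdditive` (item stmt-BirchSwinnertonDyer-20132):
# stub LOC, towards (Supply) at a general prime `p` — the TRANSVERSE condition `transverseLocalKerP` transports under
# complex conjugation (p-generic port of §3 of koly3b's `…ZhangSupplyConjStable`, `3 ↦ p¹`; its §1–§2 are `p`-free and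
# reused as they stand)
# (cell `pub/bsd-wall`, lead prover `bsd-wall-akr-p1` g3; `--supports stmt-BirchSwinnertonDyer-20132`, helper)

WHY THIS FILE. The (Stab) input of the signed jump of the GLOBAL half of (Supply) (koly3b `conjAct_mem_relaxedGroup`:
the relaxed level structure is `conjAct c`-stable) is assembled from the Kummer transport (tree
`conjAct_mem_selmerLocalKer_iff`), the transport of the level condition above the level primes (at additive `p`: the
TORIC condition — to do, see the PORT MAP in HOME/bsd-wall-akr-p1/NOTES_g3.md) and the transport of the transverse
condition at the Kolyvagin primes — this file, for the p-generic `AdditiveKoly.transverseLocalKerP`.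

WHAT. `conjAct_mem_transverseLocalKerP_of_mem`, `conjAct_mem_transverseLocalKerP_iff` — koly3b's proofs verbatim with
`3 ↦ p¹` (`[c_* x, d] = t [x, t⁻¹ d t]` for the lift `t = e h e⁻¹` stabilising `𝔓 ∩ ℤ̄`, and `t⁻¹ d t` stays in the
three subgroups: koly3b §1–§2, `p`-free).

HONEST FRAMING: theorems only; 0 definitions, 0 named facts, 0 `sorry`; closes nothing.

References: [cite: WZhang2014, §8.1 (H¹_tr)] [cite: GrossLMS1991, §5 (5.1)] [cite: NeukirchANT1999, Ch. I §9 (9.1)].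
-/

-- single-conjunct summit: `Summit.BirchSwinnertonDyer.BirchSwinnertonDyer.…` repeats the name by design
set_option linter.dupNamespace false

noncomputable section

open scoped Classical Pointwise

namespace Summit.BirchSwinnertonDyer.BirchSwinnertonDyer.Theorems.AdditiveKoly

open WeierstrassCurve NumberField IsDedekindDomain Field
  Literature.NumberTheory.EllipticCurves Literature.NumberTheory.GaloisRepresentations
  Literature.NumberTheory.Automorphic
open Summit.BirchSwinnertonDyer.Rank1Residual.X11b
open Summit.BirchSwinnertonDyer.Rank1Residual.X11b.Three.Koly.ZhangSupply.LocalConj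

variable {K : Type} [Field K] [NumberField K] (W : WeierstrassCurve ℚ) (p : ℕ)

/-- **The TRANSVERSE condition transports** (one direction, general `p`): at the place `v` of a rational prime `ℓ`
inert in the imaginary quadratic `K`, if the cocycle of `x ∈ H¹(K, E[p])` vanishes on every
`D_𝔓 ∩ Gal(K̄/K[ℓ]) ∩ Gal(K̄/K(E[p]))`, `𝔓 ∣ v`, so does the cocycle of `c_* x`: `[c_* x, d] = t [x, t⁻¹ d t]`
(`IsLiftOfAut.h1Eval_conjAct`) for the lift `t = e h e⁻¹` stabilising `𝔓 ∩ ℤ̄`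
(`exists_lift_mem_stabilizer_of_inert`), and `t⁻¹ d t` lies again in the three subgroups.
[cite: WZhang2014, §8.1 (H¹_tr)] [cite: GrossLMS1991, §5 (5.1)] -/
theorem conjAct_mem_transverseLocalKerP_of_mem (hK : IsImaginaryQuadratic K) {c : K ≃ₐ[ℚ] K} (hc : c ≠ 1)
    (ι : K →+* ℂ) {ℓ : ℕ} (hℓ : ℓ.Prime) (hprime : (Ideal.span {(ℓ : 𝓞 K)}).IsPrime)
    {v : HeightOneSpectrum (𝓞 K)} (hv : (ℓ : 𝓞 K) ∈ v.asIdeal) {x : Vp W K p}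
    (hx : x ∈ transverseLocalKerP W K p ι ℓ v) :
    conjAct W c ((p ^ 1 : ℕ) : ℤ) x ∈ transverseLocalKerP W K p ι ℓ v := by
  rw [mem_transverseLocalKerP_iff] at hx ⊢
  intro 𝔓 h𝔓 d hdD hdR hdT
  obtain ⟨h, hh, ht⟩ := exists_lift_mem_stabilizer_of_inert hK hc hℓ hprime hv h𝔓
  rw [ht.h1Eval_conjAct W ((p ^ 1 : ℕ) : ℤ) x hdT,
    hx 𝔓 h𝔓 (ht.conjGalCMH d) (conjGalCMH_mem_decompositionSubgroup ht hh hdD)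
      (conjGalCMH_mem_ringClassStabilizer hK ι hℓ.ne_zero ht hdR) (conjGalCMH_mem_torsionFixing_of_lift W ht _ hdT),
    map_zero]

/-- **The TRANSVERSE condition at an inert place is `conjAct`-invariant** (general `p`): `c_* x` is transverse at `v ∋ ℓ`
iff `x` is (the converse from `c⁻¹` and `c⁻¹_* c_* = id`). [cite: WZhang2014, §8.1 (H¹_tr)] [cite: GrossLMS1991, §5 (5.1)] -/
theorem conjAct_mem_transverseLocalKerP_iff (hK : IsImaginaryQuadratic K) {c : K ≃ₐ[ℚ] K} (hc : c ≠ 1)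
    (ι : K →+* ℂ) {ℓ : ℕ} (hℓ : ℓ.Prime) (hprime : (Ideal.span {(ℓ : 𝓞 K)}).IsPrime)
    {v : HeightOneSpectrum (𝓞 K)} (hv : (ℓ : 𝓞 K) ∈ v.asIdeal) (x : Vp W K p) :
    conjAct W c ((p ^ 1 : ℕ) : ℤ) x ∈ transverseLocalKerP W K p ι ℓ v ↔ x ∈ transverseLocalKerP W K p ι ℓ v := by
  refine ⟨fun h ↦ ?_, conjAct_mem_transverseLocalKerP_of_mem W p hK hc ι hℓ hprime hv⟩
  have hc' : c⁻¹ ≠ 1 := fun h1 ↦ hc (inv_eq_one.mp h1)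
  have h' := conjAct_mem_transverseLocalKerP_of_mem W p hK hc' ι hℓ hprime hv h
  rwa [conjAct_inv_conjAct] at h'

end Summit.BirchSwinnertonDyer.BirchSwinnertonDyer.Theorems.AdditiveKoly

end
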